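import Summits.AtomisticToContinuum.FouriersLaw.Theorems.JunctionLocalityNonBallisticDrudeLineDefs
import Summits.AtomisticToContinuum.FouriersLaw.Theorems.JunctionLocalityNonBallisticStubAutocorrelationContinuous
import Summits.AtomisticToContinuum.FouriersLaw.Theorems.JunctionLocalityNonBallisticStubTimeIntegratedCurrentMean
import Summits.AtomisticToContinuum.FouriersLaw.Theorems.JunctionLocalityNonBallisticStubEquilibriumTimeIntegratedCurrentVariance
import Summits.AtomisticToContinuum.FouriersLaw.Theorems.JunctionLocalityNonBallisticStubTimeIntegratedCurrentVarianceContinuity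
import Summits.AtomisticToContinuum.FouriersLaw.Theorems.JunctionLocalityNonBallisticStubTotalHeatPathwiseIdentity
import Summits.AtomisticToContinuum.FouriersLaw.Theorems.JunctionLocalityNonBallisticStubTotalCurrentFTURTransfer
import Summits.AtomisticToContinuum.FouriersLaw.Theorems.JunctionLocalityNonBallisticOfConeScaleCorrector

/-!
# `NonBallistic` (stmt-AtomisticToContinuum-9127) from SUB-EXTENSIVE snapshot irreversibility — the static corner of the total-current FTUR

Line `drude-controls-conductance` (R1, lead c2). With the six fixed-`N` stubs landed, the total-current fluctuation-theorem uncertainty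
relation `DrudeLine.TotalCurrentFTUR` is a theorem: `2(D_N t)² ≤ Var_eq,N(Φ_t)·(G_N t/T² + K)` for every `t > 0` and every `K` with
`KL(μ_{N,δ}‖Θ_*μ_{N,δ}) ≤ Kδ²` eventually. Its `t → 0` corner is STATIC: `Var_eq,N(Φ_t) = t²C_N(0) + o(t²)` with `C_N(0) = Var_{π_T}(J_tot)`
(continuity of `C_N`, `stub_autocorrelationContinuous`; `κ_0 = id`), so

    `2 D_N² ≤ Var_{π_T}(J_tot) · K`      — conductance² ≤ (static current variance) × (snapshot irreversibility),

and the static current variance is linear in `N` uniformly (`exists_totalCurrent_sq_le`, the landed `SubBallisticWindow` statics: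
`∫ J_tot² e^{-H/T} ≤ C_J·N·Z`). Hence a NEW two-line sufficient condition for the crux with NO dynamics, NO window and NO Green–Kubo in it:

    SUB-EXTENSIVE SNAPSHOT IRREVERSIBILITY (liminf form): `∀ ε > 0 ∀ N₀ ∃ N ≥ N₀, KL(μ_{N,δ}‖Θ_*μ_{N,δ}) ≤ ε·N·δ²` eventually as `δ → 0`,

i.e. the momentum-odd part of the steady state is `o(N)` at first order along a subsequence — STRONGER than the route item (K)
`ExtensiveSnapshotIrreversibility` (`≤ C·N·δ²`, true for the harmonic member: `K_N = N/6 - 2/9`) and FALSE for the harmonic member, so it carries the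
anharmonic content (local-equilibrium heuristics: `K_N ≍ N·G_N² ≍ ℓ²/N → 0` for a normal conductor, mean free path `ℓ`). Theorem
`nonBallistic_of_subextensiveSnapshotIrreversibility` below (registered sub-goal of stmt-AtomisticToContinuum-9127); nothing here closes the item.
-/

noncomputable section

namespace Summit.AtomisticToContinuum.FouriersLaw.Theorems.NonBallistic

open MeasureTheory ProbabilityTheory Filter Topology Set
open scoped NNReal ENNReal BigOperators
open Literature.MathematicalPhysics.KineticTheory
open Literature.MathematicalPhysics.KineticTheory.HeatConduction
open Summit.AtomisticToContinuum.FouriersLaw.Theorems.NonBallistic.DrudeLine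

/-- **Static current variance under the Gibbs PROBABILITY measure, linear in `N`**: `∫ J_tot² dπ_T ≤ C_J · N` for every `N`, from the
landed unnormalised bound `exists_totalCurrent_sq_le` (`∫ J_tot² e^{-H/T} ≤ C_J·N·∫e^{-H/T}`) and `e^{-H/T}dx = Z • π_T`. -/
theorem exists_integral_sq_totalCurrent_gibbsMeasure_le {ω₂ lam β γ : ℝ} (hω : 0 < ω₂) (hl : 0 ≤ lam) (hβ : 0 ≤ β) {T : ℝ}
    (hT : 0 < T) :
    ∃ CJ : ℝ, 0 ≤ CJ ∧ ∀ N : ℕ,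
      ∫ x, (∑ i : Fin N, (pinnedChain ω₂ lam β γ).bondCurrent N i x) ^ 2 ∂((pinnedChain ω₂ lam β γ).gibbsMeasure N T) ≤
        CJ * (N : ℝ) := by
  obtain ⟨CJ, hCJ0, hCJ⟩ := exists_totalCurrent_sq_le hω hl hβ γ hT
  refine ⟨CJ, hCJ0, fun N => ?_⟩
  set P := pinnedChain ω₂ lam β γ with hP
  have hint : Integrable (P.gibbsDensity N T) := pinnedChain_integrable_gibbsDensity hω hl hβ γ N hT
  have hZ0 : P.partitionFunction N T ≠ 0 := P.partitionFunction_ne_zero (pinnedChain_continuous_gibbsDensity ω₂ lam β γ N T)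
  have hZt : P.partitionFunction N T ≠ ⊤ := P.partitionFunction_ne_top hint
  have hZpos : 0 < (P.partitionFunction N T).toReal := ENNReal.toReal_pos hZ0 hZt
  -- `∫ e^{-H/T} = Z.toReal`
  have hZint : ∫ x : PhaseSpace N, Real.exp (-(P.hamiltonian N x) / T) = (P.partitionFunction N T).toReal := by
    rw [P.partitionFunction_eq_ofReal_integral hint, ENNReal.toReal_ofReal (integral_nonneg fun x => (P.gibbsDensity_pos N T x).le)]
    rfl
  -- `withDensity e^{-H/T} = Z • π_T`
  have hsm := Summit.AtomisticToContinuum.FouriersLaw.Theorems.pinnedChain_withDensity_eq_smul_gibbsMeasure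
    (γ := γ) (N := N) hω hl hT hβ
  have h := hCJ N
  rw [hsm, integral_smul_measure, hZint] at h
  -- divide by `Z.toReal > 0` (the real scalar action is multiplication, definitionally)
  have h'' : (P.partitionFunction N T).toReal * ∫ x, (∑ i : Fin N, P.bondCurrent N i x) ^ 2 ∂(P.gibbsMeasure N T) ≤
      CJ * (N : ℝ) * (P.partitionFunction N T).toReal := h
  have h' : (P.partitionFunction N T).toReal * ∫ x, (∑ i : Fin N, P.bondCurrent N i x) ^ 2 ∂(P.gibbsMeasure N T) ≤
      (P.partitionFunction N T).toReal * (CJ * (N : ℝ)) := by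
    calc (P.partitionFunction N T).toReal * ∫ x, (∑ i : Fin N, P.bondCurrent N i x) ^ 2 ∂(P.gibbsMeasure N T)
        ≤ CJ * (N : ℝ) * (P.partitionFunction N T).toReal := h''
      _ = (P.partitionFunction N T).toReal * (CJ * (N : ℝ)) := by ring
  exact le_of_mul_le_mul_left h' hZpos

/-- **The autocorrelation at lag `0` is the static variance**: `C_N(0) = ∫ J_tot·(κ_0 J_tot) dπ_T = ∫ J_tot² dπ_T` (`κ_0 = id`). -/
theorem autocorr_zero_eq_integral_sq {ω₂ lam β γ : ℝ} (hω : 0 < ω₂) (hl : 0 ≤ lam) (hβ : 0 ≤ β) (hγ : 0 ≤ γ) (N : ℕ) (T : ℝ) :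
    ∫ x, (∑ i : Fin N, (pinnedChain ω₂ lam β γ).bondCurrent N i x) *
        (∫ y, (∑ i : Fin N, (pinnedChain ω₂ lam β γ).bondCurrent N i y)
          ∂((pinnedChain ω₂ lam β γ).transitionKernel N T T (0 : ℝ).toNNReal x))
        ∂((pinnedChain ω₂ lam β γ).gibbsMeasure N T) =
      ∫ x, (∑ i : Fin N, (pinnedChain ω₂ lam β γ).bondCurrent N i x) ^ 2 ∂((pinnedChain ω₂ lam β γ).gibbsMeasure N T) := by
  rw [Real.toNNReal_zero, pinnedChain_transitionKernel_zero hω hl hβ hγ N T T]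
  refine integral_congr_ae (Eventually.of_forall fun x => ?_)
  simp only [ProbabilityTheory.Kernel.id_apply, integral_dirac]
  ring

/-- **The static corner of the total-current FTUR**: under weak-NESS uniqueness, along a steady-state family, for `T > 0`, response
coefficients `D`, the autocorrelation `C` pinned by its defining equation, `N ≥ 2` and every `K ≥ 0` with `KL(μ_{N,δ}‖Θ_*μ_{N,δ}) ≤ Kδ²`
eventually: `2 D_N² ≤ C_N(0) · K` — conductance² ≤ (static equilibrium variance of the total current) × (snapshot irreversibility). Proof: for
every `θ > 0` continuity of `C_N` at `0` (`stub_autocorrelationContinuous`) gives a `t > 0` with `Var_eq,N(Φ_t) ≤ t²(C_N(0)+θ)` and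
`|D_N|t/((N-1)T²) ≤ θ`; the FTUR at `(N, t, K)` divided by `t²` reads `2D_N² ≤ (C_N(0)+θ)(K+θ)`; let `θ → 0`. -/
theorem two_mul_sq_response_le_autocorr_zero_mul :
    ∀ ω₂ lam β γ : ℝ, 0 < ω₂ → 0 < lam → 0 < β → 0 < γ →
    (∀ (N : ℕ) (T_L T_R : ℝ), 0 < T_L → 0 < T_R → ∀ μ ν : Measure (PhaseSpace N),
      (pinnedChain ω₂ lam β γ).IsSteadyState N T_L T_R μ →
      (pinnedChain ω₂ lam β γ).IsSteadyState N T_L T_R ν → μ = ν) →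
    ∀ μ : (N : ℕ) → ℝ → ℝ → Measure (PhaseSpace N),
      (∀ (N : ℕ) (T_L T_R : ℝ), 0 < T_L → 0 < T_R →
        (pinnedChain ω₂ lam β γ).IsSteadyState N T_L T_R (μ N T_L T_R)) →
    ∀ T : ℝ, 0 < T → ∀ D : ℕ → ℝ,
      (∀ N : ℕ, Tendsto (fun δ : ℝ =>
        (pinnedChain ω₂ lam β γ).totalCurrent (μ N (T + δ / 2) (T - δ / 2)) / δ) (𝓝[≠] 0) (𝓝 (D N))) →
    ∀ C : ℕ → ℝ → ℝ,
      C = (fun (N : ℕ) (s : ℝ) => ∫ x, (∑ i : Fin N, (pinnedChain ω₂ lam β γ).bondCurrent N i x) *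
            (∫ y, (∑ i : Fin N, (pinnedChain ω₂ lam β γ).bondCurrent N i y)
              ∂((pinnedChain ω₂ lam β γ).transitionKernel N T T s.toNNReal x))
            ∂((pinnedChain ω₂ lam β γ).gibbsMeasure N T)) →
    ∀ N : ℕ, 2 ≤ N → ∀ K : ℝ, 0 ≤ K →
      (∀ᶠ δ in 𝓝[≠] (0 : ℝ),
        InformationTheory.klDiv (μ N (T + δ / 2) (T - δ / 2))
            ((μ N (T + δ / 2) (T - δ / 2)).map (fun x : PhaseSpace N => (x.1, -x.2)))
          ≤ ENNReal.ofReal (K * δ ^ 2)) →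
      2 * (D N) ^ 2 ≤ C N 0 * K := by
  intro ω₂ lam β γ hω hl hβ hγ huniq μ hμ T hT D hD C hC N hN2 K hK hKL
  have hA : AutocorrelationContinuous := stub_autocorrelationContinuous
  have hF : TotalCurrentFTUR := stub_totalCurrentFTURTransfer stub_timeIntegratedCurrentMean
    stub_equilibriumTimeIntegratedCurrentVariance stub_timeIntegratedCurrentVarianceContinuity stub_totalHeatPathwiseIdentity
  have hA' : Continuous (C N) := hA ω₂ lam β γ hω hl hβ hγ T hT C hC N
  have hF' := hF ω₂ lam β γ hω hl hβ hγ huniq μ hμ T hT D hD C hC N hN2 hA'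
  have hN2r : (2 : ℝ) ≤ (N : ℝ) := by exact_mod_cast hN2
  have hNm1 : 0 < (N : ℝ) - 1 := by linarith
  have hT2 : 0 < T ^ 2 := by positivity
  -- `C N 0 ≥ 0` (it is `∫ J_tot² dπ_T`)
  have hC0nn : 0 ≤ C N 0 := by
    have e : C N 0 = ∫ x, (∑ i : Fin N, (pinnedChain ω₂ lam β γ).bondCurrent N i x) ^ 2
        ∂((pinnedChain ω₂ lam β γ).gibbsMeasure N T) := by
      rw [hC]; exact autocorr_zero_eq_integral_sq hω hl.le hβ.le hγ.le N T
    rw [e]; exact integral_nonneg fun x => sq_nonneg _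
  -- for every `θ > 0`: `2 D² ≤ (C N 0 + θ) (K + θ)`
  have key : ∀ θ : ℝ, 0 < θ → 2 * (D N) ^ 2 ≤ (C N 0 + θ) * (K + θ) := by
    intro θ hθ
    -- (1) a small time: `C N s ≤ C N 0 + θ` on `[0, η)`
    obtain ⟨η, hη, hηC⟩ : ∃ η > 0, ∀ s : ℝ, |s - 0| < η → |C N s - C N 0| < θ := by
      obtain ⟨η, hη, h⟩ := Metric.continuousAt_iff.1 hA'.continuousAt θ hθ
      exact ⟨η, hη, fun s hs => by simpa [Real.dist_eq] using h (by simpa [Real.dist_eq] using hs)⟩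
    -- (2) the time `t = min (η/2) (θ (N-1) T² / (|D| + 1))`
    set t : ℝ := min (η / 2) (θ * ((N : ℝ) - 1) * T ^ 2 / (|D N| + 1)) with ht
    have htpos : 0 < t := by rw [ht]; exact lt_min (by positivity) (by positivity)
    have htD : D N / ((N : ℝ) - 1) * t / T ^ 2 ≤ θ := by
      have h1 : t ≤ θ * ((N : ℝ) - 1) * T ^ 2 / (|D N| + 1) := min_le_right _ _
      have h2 : D N / ((N : ℝ) - 1) * t / T ^ 2 ≤ |D N| / ((N : ℝ) - 1) * t / T ^ 2 := by
        have : D N ≤ |D N| := le_abs_self _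
        have h3 : D N / ((N : ℝ) - 1) ≤ |D N| / ((N : ℝ) - 1) := div_le_div_of_nonneg_right this hNm1.le
        have h4 := mul_le_mul_of_nonneg_right h3 htpos.le
        exact div_le_div_of_nonneg_right h4 hT2.le
      refine h2.trans ?_
      rw [div_mul_eq_mul_div, div_div, div_le_iff₀ (by positivity)]
      have h5 := (le_div_iff₀ (by positivity : (0 : ℝ) < |D N| + 1)).1 h1
      have habs : 0 ≤ |D N| := abs_nonneg _
      nlinarith [h5, habs, htpos]
    -- (3) the window variance at that time: `V ≤ t² (C N 0 + θ)`
    have hVle : 2 * ∫ s in (0 : ℝ)..t, (t - s) * C N s ≤ t ^ 2 * (C N 0 + θ) := by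
      have hmono : ∫ s in (0 : ℝ)..t, (t - s) * C N s ≤ ∫ s in (0 : ℝ)..t, (t - s) * (C N 0 + θ) := by
        refine intervalIntegral.integral_mono_on htpos.le ?_ ?_ fun s hs => ?_
        · exact ((continuous_const.sub continuous_id).mul hA').intervalIntegrable _ _
        · exact ((continuous_const.sub continuous_id).mul continuous_const).intervalIntegrable _ _
        · have hs0 : 0 ≤ s := hs.1
          have hst : s ≤ t := hs.2
          have htη : t ≤ η / 2 := min_le_left _ _
          have h1 : |C N s - C N 0| < θ := hηC s (by rw [sub_zero, abs_of_nonneg hs0]; linarith)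
          have h2 : C N s ≤ C N 0 + θ := by linarith [(abs_lt.1 h1).2]
          exact mul_le_mul_of_nonneg_left h2 (by linarith)
      have hval : ∫ s in (0 : ℝ)..t, (t - s) * (C N 0 + θ) = t ^ 2 / 2 * (C N 0 + θ) := by
        have h1 : ∫ s in (0 : ℝ)..t, (t - s) = t ^ 2 / 2 := by
          have h := intervalIntegral.integral_comp_sub_left (fun x : ℝ => x) t (a := 0) (b := t)
          simp only [sub_self, sub_zero] at h
          rw [h, integral_id]
          ring
        rw [intervalIntegral.integral_mul_const, h1]
      calc 2 * ∫ s in (0 : ℝ)..t, (t - s) * C N s ≤ 2 * (t ^ 2 / 2 * (C N 0 + θ)) := by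
            rw [← hval]; exact mul_le_mul_of_nonneg_left hmono (by norm_num)
        _ = t ^ 2 * (C N 0 + θ) := by ring
    -- (4) the FTUR at `(N, t, K)`, divided by `t²`
    have hstar := hF' t htpos K hK hKL
    have hfac : D N / ((N : ℝ) - 1) * t / T ^ 2 + K ≤ K + θ := by linarith
    have hVnn : 0 ≤ t ^ 2 * (C N 0 + θ) := by positivity
    -- the right factor may be negative only if the variance side makes the product small anyway; split on its sign
    by_cases hsgn : 0 ≤ D N / ((N : ℝ) - 1) * t / T ^ 2 + K
    · have h1 : 2 * D N ^ 2 * t ^ 2 ≤ t ^ 2 * (C N 0 + θ) * (K + θ) :=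
        calc 2 * D N ^ 2 * t ^ 2 ≤ (2 * ∫ s in (0 : ℝ)..t, (t - s) * C N s) * (D N / ((N : ℝ) - 1) * t / T ^ 2 + K) := hstar
          _ ≤ t ^ 2 * (C N 0 + θ) * (D N / ((N : ℝ) - 1) * t / T ^ 2 + K) := mul_le_mul_of_nonneg_right hVle hsgn
          _ ≤ t ^ 2 * (C N 0 + θ) * (K + θ) := mul_le_mul_of_nonneg_left hfac hVnn
      have ht2 : 0 < t ^ 2 := by positivity
      have h' : (2 * D N ^ 2) * t ^ 2 ≤ ((C N 0 + θ) * (K + θ)) * t ^ 2 := by nlinarith [h1]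
      exact le_of_mul_le_mul_right h' ht2
    · -- negative factor: then `D N < 0`, and the variance `V = Var(Φ_t) ≥ 0`... we only need the cheap consequence:
      -- the FTUR gives `2D²t² ≤ V · (negative) ≤ V⁺·0`-type bound; use `V ≤ t²(C0+θ)` is not enough for sign, so bound directly:
      -- `2 D² t² ≤ V * f` with `f < 0`; if `V ≥ 0` then RHS ≤ 0 so `D = 0`-like; if `V < 0` then RHS = V f ≤ t²(C0+θ)·|f|`? Avoid: use θ-independent facts.
      push Not at hsgn
      have hDneg : D N < 0 := by
        by_contra hD0; push Not at hD0
        have : 0 ≤ D N / ((N : ℝ) - 1) * t / T ^ 2 + K := by positivity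
        linarith
      -- FTUR at the SAME t but with the larger admissible constant `K' = K + |D| t/((N-1)T²) ≥ 0` makes the factor `≥ 0`:
      set K' : ℝ := K + |D N| / ((N : ℝ) - 1) * t / T ^ 2 with hK'
      have hK'nn : 0 ≤ K' := by rw [hK']; positivity
      have hKL' : ∀ᶠ δ in 𝓝[≠] (0 : ℝ),
          InformationTheory.klDiv (μ N (T + δ / 2) (T - δ / 2))
              ((μ N (T + δ / 2) (T - δ / 2)).map (fun x : PhaseSpace N => (x.1, -x.2)))
            ≤ ENNReal.ofReal (K' * δ ^ 2) := by
        filter_upwards [hKL] with δ hδ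
        refine hδ.trans (ENNReal.ofReal_le_ofReal ?_)
        have : K ≤ K' := by rw [hK']; linarith [show 0 ≤ |D N| / ((N : ℝ) - 1) * t / T ^ 2 by positivity]
        nlinarith [sq_nonneg δ]
      have hstar' := hF' t htpos K' hK'nn hKL'
      have hfac0 : 0 ≤ D N / ((N : ℝ) - 1) * t / T ^ 2 + K' := by
        rw [hK']
        have e : D N / ((N : ℝ) - 1) * t / T ^ 2 + (K + |D N| / ((N : ℝ) - 1) * t / T ^ 2) =
            K + (D N + |D N|) / ((N : ℝ) - 1) * t / T ^ 2 := by ring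
        rw [e]
        have : 0 ≤ D N + |D N| := by linarith [neg_abs_le (D N)]
        positivity
      have habsD : |D N| / ((N : ℝ) - 1) * t / T ^ 2 ≤ θ := by
        have h1 : t ≤ θ * ((N : ℝ) - 1) * T ^ 2 / (|D N| + 1) := min_le_right _ _
        rw [div_mul_eq_mul_div, div_div, div_le_iff₀ (by positivity)]
        have h5 := (le_div_iff₀ (by positivity : (0 : ℝ) < |D N| + 1)).1 h1
        have habs : 0 ≤ |D N| := abs_nonneg _
        nlinarith [h5, habs, htpos]
      have hfac' : D N / ((N : ℝ) - 1) * t / T ^ 2 + K' ≤ K + θ := by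
        rw [hK']
        have hneg : D N / ((N : ℝ) - 1) * t / T ^ 2 ≤ 0 := by
          have : D N / ((N : ℝ) - 1) ≤ 0 := div_nonpos_of_nonpos_of_nonneg hDneg.le hNm1.le
          have h2 : D N / ((N : ℝ) - 1) * t ≤ 0 := mul_nonpos_of_nonpos_of_nonneg this htpos.le
          exact div_nonpos_of_nonpos_of_nonneg h2 hT2.le
        linarith
      have h1 : 2 * D N ^ 2 * t ^ 2 ≤ t ^ 2 * (C N 0 + θ) * (K + θ) :=
        calc 2 * D N ^ 2 * t ^ 2 ≤ (2 * ∫ s in (0 : ℝ)..t, (t - s) * C N s) * (D N / ((N : ℝ) - 1) * t / T ^ 2 + K') := hstar'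
          _ ≤ t ^ 2 * (C N 0 + θ) * (D N / ((N : ℝ) - 1) * t / T ^ 2 + K') := mul_le_mul_of_nonneg_right hVle hfac0
          _ ≤ t ^ 2 * (C N 0 + θ) * (K + θ) := mul_le_mul_of_nonneg_left hfac' hVnn
      have ht2 : 0 < t ^ 2 := by positivity
      have h' : (2 * D N ^ 2) * t ^ 2 ≤ ((C N 0 + θ) * (K + θ)) * t ^ 2 := by nlinarith [h1]
      exact le_of_mul_le_mul_right h' ht2
  -- let `θ → 0`
  refine le_of_forall_pos_le_add fun ε hε => ?_
  set θ : ℝ := min 1 (ε / (C N 0 + K + 2)) with hθ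
  have hθpos : 0 < θ := by rw [hθ]; exact lt_min one_pos (by positivity)
  have hθ1 : θ ≤ 1 := min_le_left _ _
  have hθ2 : θ * (C N 0 + K + 2) ≤ ε := by
    have h1 : θ ≤ ε / (C N 0 + K + 2) := min_le_right _ _
    exact (le_div_iff₀ (by positivity)).1 h1
  have hk := key θ hθpos
  have e : (C N 0 + θ) * (K + θ) = C N 0 * K + θ * (C N 0 + K + θ) := by ring
  rw [e] at hk
  have h3 : θ * (C N 0 + K + θ) ≤ θ * (C N 0 + K + 2) := by
    refine mul_le_mul_of_nonneg_left ?_ hθpos.le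
    linarith
  linarith

/-- **`NonBallistic` from sub-extensive snapshot irreversibility** (the static corner of the landed total-current FTUR): if along every
steady-state family and for every `T > 0` the snapshot irreversibility is `o(N)` at first order along a subsequence —
`∀ ε > 0 ∀ N₀ ∃ N ≥ N₀`, `KL(μ_{N,δ}‖Θ_*μ_{N,δ}) ≤ εNδ²` eventually as `δ → 0` — then the conductance is not bounded away from `0`.
Proof: `2D_N² ≤ C_N(0)·εN ≤ C_J·ε·N²` (`two_mul_sq_response_le_autocorr_zero_mul`, `exists_integral_sq_totalCurrent_gibbsMeasure_le`) at such an
`N ≥ max(N₀, 2)` with `ε := ε²/(4(C_J+1))`, against `D_N > ε(N-1) ≥ εN/2`. -/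
theorem nonBallistic_of_subextensiveSnapshotIrreversibility :
    (∀ ω₂ lam β γ : ℝ, 0 < ω₂ → 0 < lam → 0 < β → 0 < γ →
      (∀ (N : ℕ) (T_L T_R : ℝ), 0 < T_L → 0 < T_R → ∀ μ ν : Measure (PhaseSpace N),
        (pinnedChain ω₂ lam β γ).IsSteadyState N T_L T_R μ →
        (pinnedChain ω₂ lam β γ).IsSteadyState N T_L T_R ν → μ = ν) →
      ∀ μ : (N : ℕ) → ℝ → ℝ → Measure (PhaseSpace N),
        (∀ (N : ℕ) (T_L T_R : ℝ), 0 < T_L → 0 < T_R →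
          (pinnedChain ω₂ lam β γ).IsSteadyState N T_L T_R (μ N T_L T_R)) →
      ∀ T : ℝ, 0 < T → ∀ ε : ℝ, 0 < ε → ∀ N₀ : ℕ, ∃ N : ℕ, N₀ ≤ N ∧
        ∀ᶠ δ in 𝓝[≠] (0 : ℝ),
          InformationTheory.klDiv (μ N (T + δ / 2) (T - δ / 2))
              ((μ N (T + δ / 2) (T - δ / 2)).map (fun x : PhaseSpace N => (x.1, -x.2)))
            ≤ ENNReal.ofReal (ε * (N : ℝ) * δ ^ 2)) →
    Summit.AtomisticToContinuum.FouriersLaw.Theses.JunctionLocality.NonBallistic := by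
  intro hS ω₂ lam β γ hω hl hβ hγ huniq μ hμ T hT D hD ε hε N₀
  -- the equilibrium total-current autocorrelation, keyed once
  set Cf : ℕ → ℝ → ℝ := fun (N : ℕ) (s : ℝ) =>
      ∫ x, (∑ i : Fin N, (pinnedChain ω₂ lam β γ).bondCurrent N i x) *
        (∫ y, (∑ i : Fin N, (pinnedChain ω₂ lam β γ).bondCurrent N i y)
          ∂((pinnedChain ω₂ lam β γ).transitionKernel N T T s.toNNReal x))
        ∂((pinnedChain ω₂ lam β γ).gibbsMeasure N T) with hCf
  have hcorner := two_mul_sq_response_le_autocorr_zero_mul ω₂ lam β γ hω hl hβ hγ huniq μ hμ T hT D hD Cf hCf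
  obtain ⟨CJ, hCJ0, hCJ⟩ := exists_integral_sq_totalCurrent_gibbsMeasure_le (γ := γ) hω hl.le hβ.le hT
  have hC0 : ∀ N : ℕ, Cf N 0 ≤ CJ * (N : ℝ) := fun N => by
    have e : Cf N 0 = ∫ x, (∑ i : Fin N, (pinnedChain ω₂ lam β γ).bondCurrent N i x) ^ 2
        ∂((pinnedChain ω₂ lam β γ).gibbsMeasure N T) := by
      rw [hCf]; exact autocorr_zero_eq_integral_sq hω hl.le hβ.le hγ.le N T
    rw [e]; exact hCJ N
  -- sub-extensivity at `ε' = ε²/(4 (CJ+1))`, at some `N ≥ max N₀ 2`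
  set ε' : ℝ := ε ^ 2 / (4 * (CJ + 1)) with hε'
  have hε'pos : 0 < ε' := by rw [hε']; positivity
  obtain ⟨N, hN, hKL⟩ := hS ω₂ lam β γ hω hl hβ hγ huniq μ hμ T hT ε' hε'pos (max N₀ 2)
  have hN₀ : N₀ ≤ N := le_trans (le_max_left _ _) hN
  have hN2 : 2 ≤ N := le_trans (le_max_right _ _) hN
  refine ⟨N, hN₀, ?_⟩
  by_contra hcon
  push Not at hcon
  have hN2r : (2 : ℝ) ≤ (N : ℝ) := by exact_mod_cast hN2
  have hNpos : (0 : ℝ) < (N : ℝ) := by linarith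
  have hKnn : 0 ≤ ε' * (N : ℝ) := by positivity
  have h1 : 2 * (D N) ^ 2 ≤ Cf N 0 * (ε' * (N : ℝ)) := hcorner N hN2 (ε' * (N : ℝ)) hKnn hKL
  have h2 : 2 * (D N) ^ 2 ≤ ε' * (CJ + 1) * (N : ℝ) ^ 2 := by
    calc 2 * (D N) ^ 2 ≤ Cf N 0 * (ε' * (N : ℝ)) := h1
      _ ≤ (CJ * (N : ℝ) + (N : ℝ)) * (ε' * (N : ℝ)) := by
          refine mul_le_mul_of_nonneg_right ?_ hKnn
          have hN1 : (0 : ℝ) ≤ (N : ℝ) := hNpos.le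
          linarith [hC0 N]
      _ = ε' * (CJ + 1) * (N : ℝ) ^ 2 := by ring
  have h3 : ε' * (CJ + 1) = ε ^ 2 / 4 := by rw [hε']; field_simp
  rw [h3] at h2
  -- against `D N > ε (N-1) ≥ ε N / 2`
  have h5 : ε * (N : ℝ) / 2 ≤ D N := by nlinarith [hcon]
  have h6 : (ε * (N : ℝ) / 2) ^ 2 ≤ D N ^ 2 := pow_le_pow_left₀ (by positivity) h5 2
  have h7 : 0 < ε ^ 2 * (N : ℝ) ^ 2 := by positivity
  nlinarith [h2, h6, h7]

end Summit.AtomisticToContinuum.FouriersLaw.Theorems.NonBallistic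

end
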